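import Summits.FinalStateConjecture.FinalStateConjecture.Theorems.ClusterCompletenessOmegaLimitMultiKerrBirthDefs
import Summits.FinalStateConjecture.FinalStateConjecture.Theorems.ClusterCompletenessOmegaLimitMultiKerrStubOrderUpgradeAssembly
import Summits.FinalStateConjecture.FinalStateConjecture.Theorems.ClusterCompletenessLinearToNonlinearCaptureStubRaysStayInClosureTransferCofinal
import HarnessLib

/-!
# Route ClusterCompleteness · crux `LinearToNonlinearCapture` — the recurrent chart data of `RecursO`
# with every object EXPOSED (`RecurrentCharts`; posited-object vocabulary, D-0016 `<Route>Defs` convention)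

`RecursO k 𝒟` (…OmegaLimitMultiKerrBirthDefs) — the hypothesis of the route target
`RecurrentMultiKerrCapture` at order `k`, one development at a time — packs its eleven objects (the
exterior `O`, the number of holes `N`, labels `M a`, motions `mo`, the late time `τ₀`, the hole
charts `Ψ`, the tube and near-zone radii `ρ R`, the flat domain `U₀` and the flat chart `Ψ₀`) under
one existential, followed by the thirteen clauses C1–C13. Every stub of a capture line that has to
SAY something about those charts (the manufacture of restart layers from `Ψ₀` and the `Ψᵢ`, the
cofinality of a restart's charts over the late recurrent images, the interior collar extending the
`Ψᵢ` inward) must otherwise restate the 3.3 kB block clause by clause (cf. the explicit hypotheses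
of `exteriorOf_recurrentCharts_eq_late`). This file names the block with its objects as parameters:

* `RecurrentCharts k 𝒟 O N M a mo τ₀ Ψ ρ R U₀ Ψ₀` — C1–C13 VERBATIM (the body of `RecursO`);
* `recursO_iff_exists_recurrentCharts` — `RecursO k 𝒟 ↔ ∃ …, RecurrentCharts k 𝒟 …` (`Iff.rfl`);
* clause accessors `RecurrentCharts.subextremal` (C1) … `RecurrentCharts.recur` (C13), antitonicity
  in the order `RecurrentCharts.anti`, and the two consequences every capture line uses, over the
  landed ray-clause plumbing: `RecurrentCharts.exteriorOf_eq_late` (for every `τ₁ > τ₀` the exterior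
  `O` is the exterior of the late chart images after `τ₁`) and `RecurrentCharts.raysStayInClosure_late`.

Everything is a definition over existing declarations or a projection; no new mathematics.
References: Dafermos–Luk arXiv:1710.01722, §1.2.1 and Conjecture 1 (the final-state charts);
O'Neill 1983, Ch. 14 (causal plumbing, through the imported landed file).
-/

-- every `Summit.FinalStateConjecture.FinalStateConjecture.…` name repeats the summit = sub-problem segment (D-0017 layout)
set_option linter.dupNamespace false

noncomputable section

open scoped Manifold ContDiff Topology ENNReal
open Set Filter Function TopologicalSpace

namespace Summit.FinalStateConjecture.FinalStateConjecture.Theorems.ClusterCompleteness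

open Literature.Geometry.Lorentzian

variable {X : Type} [TopologicalSpace X] [ChartedSpace E3 X] [IsManifold (𝓡 3) ∞ X]
  [ConnectedSpace X] {D : InitialDataSet (𝓡 3) X}

/-- **The recurrent chart data of `RecursO k 𝒟`, objects exposed.** For a vacuum Cauchy development
`𝒟`, an exterior `O`, `N` holes with labels `(Mᵢ, aᵢ)` and motions `(Λᵢ, cᵢ)`, a late time `τ₀`, hole
charts `Ψᵢ` on the boosted Kerr exteriors, tube radii `ρᵢ` and near-zone radii `Rᵢ`, a flat domain
`U₀` with flat chart `Ψ₀`: the thirteen clauses C1–C13 of `RecursO` VERBATIM — sub-extremal labels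
(C1), late hole charts (C2) and late flat chart (C3) into `O`, sublinear tubes (C4), honest radii
(C5), tube complement inside `U₀` (C6), separation at every radius (C7), `O = exteriorOf charted`
(C8), rays stay in `closure O` (C9), exhaustion at every chart time (C10), orthochronous motions and
future-directed flat chart time (C11), the uniform `C⁰` anchor `1/4` (C12), and `Cᵏ` `ε`-recurrence
at every radius with future-directed transported Kerr time vectors (C13).
[cite: DafermosLuk2017, §1.2.1] -/
def RecurrentCharts (k : ℕ) (𝒟 : VacuumCauchyDevelopment D) (O : Set 𝒟.carrier) (N : ℕ)
    (M a : Fin N → ℝ) (mo : Fin N → lorentzGroup × E4) (τ₀ : ℝ)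
    (Ψ : ∀ i, boostedKerrExterior (mo i).1 (mo i).2 (M i) (a i) → 𝒟.carrier) (ρ R : Fin N → ℝ → ℝ)
    (U₀ : Opens E4) (Ψ₀ : U₀ → 𝒟.carrier) : Prop :=
  (∀ i, Kerr.IsSubextremal (M i) (a i)) ∧ (∀ i,
    𝒟.toSpacetime.IsLateChart (boostedKerrBackground (mo i).1 (mo i).2 (M i) (a i)) O τ₀ (Ψ i)) ∧
    𝒟.toSpacetime.IsLateChart (Minkowski.backgroundOn U₀) O τ₀ Ψ₀ ∧ (∀ i, Tendsto (fun t ↦ ρ i t /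
    t) atTop (𝓝 0)) ∧ (∀ i, Tendsto (R i) atTop atTop ∧ ∀ τ, max (Kerr.rPlus (M i) (a i)) 0 + 1 ≤ R
    i τ) ∧ {x : E4 | τ₀ < x 0 ∧ ∀ i, ρ i (x 0) < Kerr.radius (a i) (poincareInv (mo i).1 (mo i).2
    x)} ⊆ (U₀ : Set E4) ∧ (∀ R' : ℝ, ∃ τ₁ : ℝ, Pairwise (Function.onFun Disjoint fun i ↦ Ψ i ''
    (boostedKerrBackground (mo i).1 (mo i).2 (M i) (a i)).truncLateRegion τ₁ R')) ∧ O =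
    Summit.FinalStateConjecture.exteriorOf 𝒟.toCauchyDevelopment ((⋃ i, Ψ i ''
    (boostedKerrBackground (mo i).1 (mo i).2 (M i) (a i)).lateRegion τ₀) ∪ Ψ₀ ''
    (Minkowski.backgroundOn U₀).lateRegion τ₀) ∧ Summit.FinalStateConjecture.RaysStayInClosure
    𝒟.toCauchyDevelopment O ∧ (∀ τ₁ : ℝ, τ₀ < τ₁ → O \ (Ψ₀ '' (Minkowski.backgroundOn U₀).lateRegion
    τ₁ ∪ ⋃ i, Ψ i '' {x | τ₁ < (boostedKerrBackground (mo i).1 (mo i).2 (M i) (a i)).time x.1 ∧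
    (boostedKerrBackground (mo i).1 (mo i).2 (M i) (a i)).radius x.1 ≤ R i ((boostedKerrBackground
    (mo i).1 (mo i).2 (M i) (a i)).time x.1)}) ⊆ 𝒟.metric.causalPast 𝒟.timeOrientation (Ψ₀ ''
    (Minkowski.backgroundOn U₀).timeSlab τ₁ ∪ ⋃ i, Ψ i '' (boostedKerrBackground (mo i).1 (mo i).2
    (M i) (a i)).truncTimeSlab (R i τ₁) τ₁)) ∧ ((∀ i, Summit.FinalStateConjecture.IsOrthochronous
    (mo i).1) ∧ ∀ τ : ℝ, τ₀ < τ → ∀ x ∈ (Minkowski.backgroundOn U₀).timeSlab τ,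
    𝒟.toSpacetime.timeOrientation.IsFutureDirected (mfderiv 𝓘(ℝ, E4) (𝓡 4) Ψ₀ x (E4.basisVector 0)))
    ∧ (∀ τ : ℝ, τ₀ < τ → 𝒟.toSpacetime.deviationCk (Minkowski.backgroundOn U₀) Ψ₀ 0 τ ≤
    ENNReal.ofReal (1 / 4) ∧ ∀ i, 𝒟.toSpacetime.truncDeviationCk (boostedKerrBackground (mo i).1 (mo
    i).2 (M i) (a i)) (Ψ i) 0 (R i τ) τ ≤ ENNReal.ofReal (1 / 4)) ∧ ∀ R' : ℝ, ∀ ε : ℝ, 0 < ε → ∃ᶠ τ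
    in atTop, 𝒟.toSpacetime.deviationCk (Minkowski.backgroundOn U₀) Ψ₀ k τ ≤ ENNReal.ofReal ε ∧ ∀ i,
    𝒟.toSpacetime.truncDeviationCk (boostedKerrBackground (mo i).1 (mo i).2 (M i) (a i)) (Ψ i) k R'
    τ ≤ ENNReal.ofReal ε ∧ ∀ x ∈ (boostedKerrBackground (mo i).1 (mo i).2 (M i) (a i)).truncTimeSlab
    R' τ, 𝒟.toSpacetime.timeOrientation.IsFutureDirected (mfderiv 𝓘(ℝ, E4) (𝓡 4) (Ψ i) x (((mo i).1
    : E4 ≃L[ℝ] E4) (Kerr.timeVector (M i) (a i) (poincareInv (mo i).1 (mo i).2 (x : E4)))))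

/-- **Read-back (`Iff.rfl`):** `RecursO k 𝒟` is the existence of recurrent chart data.
[cite: DafermosLuk2017, §1.2.1] -/
theorem recursO_iff_exists_recurrentCharts {k : ℕ} {𝒟 : VacuumCauchyDevelopment D} :
    RecursO k 𝒟 ↔ ∃ (O : Set 𝒟.carrier) (N : ℕ) (M a : Fin N → ℝ) (mo : Fin N → lorentzGroup × E4)
      (τ₀ : ℝ) (Ψ : ∀ i, boostedKerrExterior (mo i).1 (mo i).2 (M i) (a i) → 𝒟.carrier)
      (ρ R : Fin N → ℝ → ℝ) (U₀ : Opens E4) (Ψ₀ : U₀ → 𝒟.carrier),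
      RecurrentCharts k 𝒟 O N M a mo τ₀ Ψ ρ R U₀ Ψ₀ :=
  Iff.rfl

namespace RecurrentCharts

variable {k : ℕ} {𝒟 : VacuumCauchyDevelopment D} {O : Set 𝒟.carrier} {N : ℕ} {M a : Fin N → ℝ}
  {mo : Fin N → lorentzGroup × E4} {τ₀ : ℝ}
  {Ψ : ∀ i, boostedKerrExterior (mo i).1 (mo i).2 (M i) (a i) → 𝒟.carrier} {ρ R : Fin N → ℝ → ℝ}
  {U₀ : Opens E4} {Ψ₀ : U₀ → 𝒟.carrier}

/-- The packed form: recurrent chart data witness `RecursO k 𝒟`. [cite: DafermosLuk2017, §1.2.1] -/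
theorem recursO (h : RecurrentCharts k 𝒟 O N M a mo τ₀ Ψ ρ R U₀ Ψ₀) : RecursO k 𝒟 :=
  ⟨O, N, M, a, mo, τ₀, Ψ, ρ, R, U₀, Ψ₀, h⟩

/-- C1: every label is sub-extremal. [cite: DafermosLuk2017, §1.2.1] -/
theorem subextremal (h : RecurrentCharts k 𝒟 O N M a mo τ₀ Ψ ρ R U₀ Ψ₀) (i : Fin N) :
    Kerr.IsSubextremal (M i) (a i) :=
  h.1 i

/-- C2: every hole chart is a late chart into `O` after `τ₀`. [cite: DafermosLuk2017, §1.2.1] -/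
theorem isLateChart_hole (h : RecurrentCharts k 𝒟 O N M a mo τ₀ Ψ ρ R U₀ Ψ₀) (i : Fin N) :
    𝒟.toSpacetime.IsLateChart (boostedKerrBackground (mo i).1 (mo i).2 (M i) (a i)) O τ₀ (Ψ i) :=
  h.2.1 i

/-- C3: the flat chart is a late chart into `O` after `τ₀`. [cite: DafermosLuk2017, §1.2.1] -/
theorem isLateChart_flat (h : RecurrentCharts k 𝒟 O N M a mo τ₀ Ψ ρ R U₀ Ψ₀) :
    𝒟.toSpacetime.IsLateChart (Minkowski.backgroundOn U₀) O τ₀ Ψ₀ :=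
  h.2.2.1

/-- C4: the tube radii grow sublinearly. [cite: DafermosLuk2017, §1.2.1] -/
theorem tendsto_excision_div (h : RecurrentCharts k 𝒟 O N M a mo τ₀ Ψ ρ R U₀ Ψ₀) (i : Fin N) :
    Tendsto (fun t ↦ ρ i t / t) atTop (𝓝 0) :=
  h.2.2.2.1 i

/-- C5: honest near-zone radii (`Rᵢ → ∞`, `Rᵢ(τ) ≥ max(r₊, 0) + 1`). [cite: DafermosLuk2017, §1.2.1] -/
theorem radii (h : RecurrentCharts k 𝒟 O N M a mo τ₀ Ψ ρ R U₀ Ψ₀) (i : Fin N) :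
    Tendsto (R i) atTop atTop ∧ ∀ τ, max (Kerr.rPlus (M i) (a i)) 0 + 1 ≤ R i τ :=
  h.2.2.2.2.1 i

/-- C6: the late half-space minus the tubes lies in the flat domain. [cite: DafermosLuk2017, §1.2.1] -/
theorem tubes_subset (h : RecurrentCharts k 𝒟 O N M a mo τ₀ Ψ ρ R U₀ Ψ₀) :
    {x : E4 | τ₀ < x 0 ∧ ∀ i, ρ i (x 0) < Kerr.radius (a i) (poincareInv (mo i).1 (mo i).2 x)} ⊆
      (U₀ : Set E4) :=
  h.2.2.2.2.2.1

/-- C7: the truncated world-tubes separate at every radius. [cite: DafermosLuk2017, §1.2.1] -/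
theorem separate (h : RecurrentCharts k 𝒟 O N M a mo τ₀ Ψ ρ R U₀ Ψ₀) (R' : ℝ) :
    ∃ τ₁ : ℝ, Pairwise (Function.onFun Disjoint fun i ↦ Ψ i ''
      (boostedKerrBackground (mo i).1 (mo i).2 (M i) (a i)).truncLateRegion τ₁ R') :=
  h.2.2.2.2.2.2.1 R'

/-- C8: `O` is the self-determined exterior of the charted late regions. [cite: DafermosLuk2017, §1.2.1] -/
theorem exterior_eq (h : RecurrentCharts k 𝒟 O N M a mo τ₀ Ψ ρ R U₀ Ψ₀) :
    O = Summit.FinalStateConjecture.exteriorOf 𝒟.toCauchyDevelopment ((⋃ i, Ψ i ''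
      (boostedKerrBackground (mo i).1 (mo i).2 (M i) (a i)).lateRegion τ₀) ∪ Ψ₀ ''
      (Minkowski.backgroundOn U₀).lateRegion τ₀) :=
  h.2.2.2.2.2.2.2.1

/-- C9: every future-complete normalised null ray from the data stays in `closure O`.
[cite: DafermosLuk2017, §1.2.1] -/
theorem raysStayInClosure (h : RecurrentCharts k 𝒟 O N M a mo τ₀ Ψ ρ R U₀ Ψ₀) :
    Summit.FinalStateConjecture.RaysStayInClosure 𝒟.toCauchyDevelopment O :=
  h.2.2.2.2.2.2.2.2.1

/-- C10: exhaustion of `O` at every chart time `τ₁ > τ₀`. [cite: DafermosLuk2017, §1.2.1] -/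
theorem exhaust (h : RecurrentCharts k 𝒟 O N M a mo τ₀ Ψ ρ R U₀ Ψ₀) {τ₁ : ℝ} (hτ₁ : τ₀ < τ₁) :
    O \ (Ψ₀ '' (Minkowski.backgroundOn U₀).lateRegion τ₁ ∪ ⋃ i, Ψ i '' {x | τ₁ <
      (boostedKerrBackground (mo i).1 (mo i).2 (M i) (a i)).time x.1 ∧
      (boostedKerrBackground (mo i).1 (mo i).2 (M i) (a i)).radius x.1 ≤ R i ((boostedKerrBackground
      (mo i).1 (mo i).2 (M i) (a i)).time x.1)}) ⊆ 𝒟.metric.causalPast 𝒟.timeOrientation (Ψ₀ ''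
      (Minkowski.backgroundOn U₀).timeSlab τ₁ ∪ ⋃ i, Ψ i '' (boostedKerrBackground (mo i).1 (mo i).2
      (M i) (a i)).truncTimeSlab (R i τ₁) τ₁) :=
  h.2.2.2.2.2.2.2.2.2.1 τ₁ hτ₁

/-- C11: orthochronous motions and future-directed flat chart time on every late flat slab.
[cite: DafermosLuk2017, §1.2.1] -/
theorem oriented (h : RecurrentCharts k 𝒟 O N M a mo τ₀ Ψ ρ R U₀ Ψ₀) :
    (∀ i, Summit.FinalStateConjecture.IsOrthochronous (mo i).1) ∧ ∀ τ : ℝ, τ₀ < τ → ∀ x ∈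
      (Minkowski.backgroundOn U₀).timeSlab τ, 𝒟.toSpacetime.timeOrientation.IsFutureDirected
      (mfderiv 𝓘(ℝ, E4) (𝓡 4) Ψ₀ x (E4.basisVector 0)) :=
  h.2.2.2.2.2.2.2.2.2.2.1

/-- C12: the uniform `C⁰` anchor `1/4` on every late flat slab and certified near-zone slab.
[cite: DafermosLuk2017, §1.2.1] -/
theorem anchor (h : RecurrentCharts k 𝒟 O N M a mo τ₀ Ψ ρ R U₀ Ψ₀) {τ : ℝ} (hτ : τ₀ < τ) :
    𝒟.toSpacetime.deviationCk (Minkowski.backgroundOn U₀) Ψ₀ 0 τ ≤ ENNReal.ofReal (1 / 4) ∧ ∀ i,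
      𝒟.toSpacetime.truncDeviationCk (boostedKerrBackground (mo i).1 (mo i).2 (M i) (a i)) (Ψ i) 0
      (R i τ) τ ≤ ENNReal.ofReal (1 / 4) :=
  h.2.2.2.2.2.2.2.2.2.2.2.1 τ hτ

/-- C13: `Cᵏ` `ε`-recurrence at every radius, with future-directed transported Kerr time vectors
at the recurrence times. [cite: DafermosLuk2017, §1.2.1] -/
theorem recur (h : RecurrentCharts k 𝒟 O N M a mo τ₀ Ψ ρ R U₀ Ψ₀) (R' : ℝ) {ε : ℝ} (hε : 0 < ε) :
    ∃ᶠ τ in atTop, 𝒟.toSpacetime.deviationCk (Minkowski.backgroundOn U₀) Ψ₀ k τ ≤ ENNReal.ofReal ε ∧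
      ∀ i, 𝒟.toSpacetime.truncDeviationCk (boostedKerrBackground (mo i).1 (mo i).2 (M i) (a i)) (Ψ i)
      k R' τ ≤ ENNReal.ofReal ε ∧ ∀ x ∈ (boostedKerrBackground (mo i).1 (mo i).2 (M i) (a
      i)).truncTimeSlab R' τ, 𝒟.toSpacetime.timeOrientation.IsFutureDirected (mfderiv 𝓘(ℝ, E4) (𝓡 4)
      (Ψ i) x (((mo i).1 : E4 ≃L[ℝ] E4) (Kerr.timeVector (M i) (a i) (poincareInv (mo i).1 (mo i).2 (x
      : E4))))) :=
  h.2.2.2.2.2.2.2.2.2.2.2.2 R' ε hε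

/-- The chart data recur at every LOWER order too (`RecursO` is antitone in `k`, same charts).
[cite: DafermosLuk2017, §1.2.1] -/
theorem anti {k' : ℕ} (hk : k' ≤ k) (h : RecurrentCharts k 𝒟 O N M a mo τ₀ Ψ ρ R U₀ Ψ₀) :
    RecurrentCharts k' 𝒟 O N M a mo τ₀ Ψ ρ R U₀ Ψ₀ := by
  obtain ⟨h1, h2, h3, h4, h5, h6, h7, h8, h9, h10, h11, h12, h13⟩ := h
  refine ⟨h1, h2, h3, h4, h5, h6, h7, h8, h9, h10, h11, h12, fun R' ε hε ↦ ?_⟩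
  refine (h13 R' ε hε).mono fun τ hτ ↦ ⟨?_, fun i ↦ ⟨?_, (hτ.2 i).2⟩⟩
  · exact (𝒟.toSpacetime.deviationCk_mono (Minkowski.backgroundOn U₀) Ψ₀ hk τ).trans hτ.1
  · exact (supCkENorm_mono_right _ hk _).trans (hτ.2 i).1

section Late

variable [T2Space X] [SecondCountableTopology X]

/-- **Late images determine the exterior.** For recurrent chart data and every `τ₁ > τ₀`, `O` is
the exterior of the late chart images after `τ₁` (landed `exteriorOf_recurrentCharts_eq_late`,
from C2, C3, C8, C10). O'Neill 1983, Ch. 14, pp. 402–404. [cite: DafermosLuk2017, Conjecture 1] -/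
theorem exteriorOf_eq_late (h : RecurrentCharts k 𝒟 O N M a mo τ₀ Ψ ρ R U₀ Ψ₀) {τ₁ : ℝ}
    (hτ₁ : τ₀ < τ₁) :
    O = Summit.FinalStateConjecture.exteriorOf 𝒟.toCauchyDevelopment ((⋃ i, Ψ i ''
      (boostedKerrBackground (mo i).1 (mo i).2 (M i) (a i)).lateRegion τ₁) ∪ Ψ₀ ''
      (Minkowski.backgroundOn U₀).lateRegion τ₁) :=
  Theorems.exteriorOf_recurrentCharts_eq_late 𝒟 h.isLateChart_hole h.isLateChart_flat h.exterior_eq hτ₁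
    (h.exhaust hτ₁)

/-- **The ray clause transfers to the late images.** For recurrent chart data and every
`τ₁ > τ₀`, the exterior of the late chart images after `τ₁` captures the complete rays (landed
`raysStayInClosure_recurrentCharts_late`, from C2, C3, C8, C9, C10). [cite: DafermosLuk2017, Conjecture 1] -/
theorem raysStayInClosure_late (h : RecurrentCharts k 𝒟 O N M a mo τ₀ Ψ ρ R U₀ Ψ₀) {τ₁ : ℝ}
    (hτ₁ : τ₀ < τ₁) :
    Summit.FinalStateConjecture.RaysStayInClosure 𝒟.toCauchyDevelopment
      (Summit.FinalStateConjecture.exteriorOf 𝒟.toCauchyDevelopment ((⋃ i, Ψ i ''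
      (boostedKerrBackground (mo i).1 (mo i).2 (M i) (a i)).lateRegion τ₁) ∪ Ψ₀ ''
      (Minkowski.backgroundOn U₀).lateRegion τ₁)) :=
  Theorems.raysStayInClosure_recurrentCharts_late 𝒟 h.isLateChart_hole h.isLateChart_flat h.exterior_eq
    h.raysStayInClosure hτ₁ (h.exhaust hτ₁)

end Late

end RecurrentCharts

end Summit.FinalStateConjecture.FinalStateConjecture.Theorems.ClusterCompleteness

end
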